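/-
Copyright (c) 2026 the pub-hodgecm-mathlib formalisation cell (harness21).  Prover seat hodgecm-mathlib-LH4-p09 (g11) (K1b desk K2Liu-p14 (g5) DESK WORD #11 (β)
«the ARCH HALF of `hBL₁`»), Track B «K2-LIT» ∕ hLiu418 socket #41 KIND 1, package (K1b-♮), letter (dec-2): THE ARCHIMEDEAN PER-PLACE FACTOR FOR THE `M`-BOUNDED MOVER
CLASS — the payer-chosen rate.  THEOREMS ONLY.
-/
import Summits.HodgeConjecture.HodgeConjecture.Theorems.K2LiuKindOneLineCornerArchFactor        -- ★ (β-2) `norm_corner_lineWhittaker_le_of_blockDecomp` (this seat)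
import Summits.HodgeConjecture.HodgeConjecture.Theorems.K2LiuSiegelEisensteinKindWBlockAtPoint  -- ★ p862843 `exists_blockUpper_mul_unitary`
import Summits.HodgeConjecture.HodgeConjecture.Theorems.K2LiuKindOneLineCornerBlockFaces        -- ★ (dec-3c) `sq_sum_le_card_mul_sum_sq` (+ ★ (dec-3b-ii) `rpow_le_rpow_abs`)
import HarnessLib

/-!
# Crux `HLiu418`, socket #41, KIND 1 — (dec-2)∕(β) `K2LiuKindOneLineCornerArchFactorBounded`: THE PER-PLACE FACTOR FOR `M`-BOUNDED MOVERS (PAYER-CHOSEN RATE)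

Cell `hodgecm-mathlib`, crux item hLiu418 = `stmt-HodgeConjecture-24832` (helper lane `--supports … --as helper`, count-neutral), route of record `HCCMUnconditional`;
squad K2 ∕ K2Liu; K1b desk K2Liu-p14 (g5) DESK WORD #11 (β) (2026-09-05T01:42:53Z).  THEOREMS ONLY (no `def`, no `instance`, no notation, no named-fact hypothesis,
no `sorry`).

THE POINT.  ★ (β-2) `K2LiuKindOneLineCornerArchFactor.norm_corner_lineWhittaker_le_of_blockDecomp` serves the block letter `hBL₁` of ★ p864248 at its frozen Gaussian rate `π`
for UNITARY movers.  `hBL₁` as typed quantifies over the wider class «`κ κ′ = 1`, entries of `κ, κ′` bounded by `M`» (★ G7 currency).  On that class the corner row `ρ = Σ_j ‖Y 1 j‖²`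
of the decomposition and the row `ρ₀` of a unitary-mover decomposition of the SAME point are only comparable within `64M²` (`Y = Y₀·V₁₁`, `V = k₀κ′` block-upper of entries
`≤ 4M`), so — the left side being mover-free — a Gaussian in `ρ` can only be had at a PAYER-CHOSEN rate.  THIS FILE proves exactly that statement:
**`norm_corner_lineWhittaker_le_of_boundedMovers`** — same letters as ★ (β-2) §1, mover `κκ′ = 1` with entries `≤ M` (`M ≥ 1`):
`‖∫ f(ι(J₁ n₁(t)) · g) e^{−2πiμt} dt‖ ≤ C_L (64M²)^{|2re s+1|+1} (32M²)^{|2re s+2|} · ρ^{−(2re s+1)} ‖det Y‖^{2re s+2} ((1 + |μ|ρ) e^{−(π∕64M²)|μ|ρ})`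
(§1 comparison lemmas `norm_unitary_mul_apply_le`, `norm_mul_unitary_conjTranspose_apply_le`, `rowSq_mul_le`, `rpow_le_mul_rpow_of_two_sided`; ★ p862843's block QR for the
unitary-mover decomposition; ★ (β-2) §1 there; two-sided transfer of the four factors).  This is the (R2) «payer-chosen rate» reading of the mover-class finding (K2 bus
2026-09-05T01:51:05Z (2)); under (R1) «unitary movers only» ★ (β-2) §1 is already the head.
HONEST LABEL.  Count-neutral helper, hypothesis-first in the two letters; closes no socket: `HC_CM` is proved only modulo the 7 printed citations (2 remaining named inputs: hLiu418 =
`stmt-HodgeConjecture-24832`, h413 = `stmt-HodgeConjecture-24833`) until rung 0 closes.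
[BorelJacquet1979, §1.2, §4.1]; [MoeglinWaldspurger1995, I.2.2, II.1.7]; [Shimura1997, §16, §18.4].
-/

set_option autoImplicit false
set_option linter.dupNamespace false -- the mandated namespace repeats `HodgeConjecture.HodgeConjecture`

noncomputable section

namespace Summit.HodgeConjecture.HodgeConjecture.Cruxes.HLiu418.K2LiuKindOneLineCornerArchFactorBounded

open Matrix Complex MeasureTheory
open scoped ComplexConjugate Matrix BigOperators
open Literature.NumberTheory.ModularForms.SiegelUpperHalfSpace (moeb)
open Summit.HodgeConjecture.HodgeConjecture.Cruxes.HLiu418.K2LiuArchInducedTubeDefs (IsArchSiegelSection)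
open Summit.HodgeConjecture.HodgeConjecture.Cruxes.HLiu418.K2LiuKindOneLineCornerArchFactor (norm_corner_lineWhittaker_le_of_blockDecomp)

/-! ## §1 Comparison lemmas and the head for `M`-bounded movers -/

section BoundedMovers

open Summit.HodgeConjecture.HodgeConjecture.Cruxes.HLiu418.K2LiuSiegelEisensteinKindWBlockAtPoint (exists_blockUpper_mul_unitary)
open Summit.HodgeConjecture.HodgeConjecture.Cruxes.HLiu418.K2LiuArchBlockHeightBound (norm_det_le_of_entry_le)
open Summit.HodgeConjecture.HodgeConjecture.Cruxes.HLiu418.K2LiuKindOneLineCornerBlockFaces (sq_sum_le_card_mul_sum_sq)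
open Summit.HodgeConjecture.HodgeConjecture.Cruxes.HLiu418.K2LiuKindOneLineDecayLowerPowerFace (rpow_le_rpow_abs)

variable (ι : Matrix (Fin 1 ⊕ Fin 1) (Fin 1 ⊕ Fin 1) ℂ → Matrix (Fin 2 ⊕ Fin 2) (Fin 2 ⊕ Fin 2) ℂ)
    (hι : ∀ x, ι x = fromBlocks !![1, 0; 0, x (Sum.inl 0) (Sum.inl 0)] !![0, 0; 0, x (Sum.inl 0) (Sum.inr 0)] !![0, 0; 0, x (Sum.inr 0) (Sum.inl 0)] !![1, 0; 0, x (Sum.inr 0) (Sum.inr 0)])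

/-- entries of `k · κ′` for `k` unitary (entries `≤ 1`) and `κ′` with entries `≤ M`: `≤ 4M`. [folklore] -/
theorem norm_unitary_mul_apply_le {k κ' : Matrix (Fin 2 ⊕ Fin 2) (Fin 2 ⊕ Fin 2) ℂ} (hk : k ∈ Matrix.unitaryGroup (Fin 2 ⊕ Fin 2) ℂ) {M : ℝ}
    (hκ'e : ∀ i j, ‖κ' i j‖ ≤ M) (i j : Fin 2 ⊕ Fin 2) : ‖(k * κ') i j‖ ≤ 4 * M := by
  have h := K2LiuArchBlockHeightBound.norm_mul_apply_le zero_le_one (fun i j => entry_norm_bound_of_unitary hk i j) hκ'e i j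
  simpa [Fintype.card_sum, Fintype.card_fin] using h

/-- entries of `κ · kᴴ` for `κ` with entries `≤ M` (`M ≥ 0`) and `k` unitary: `≤ 4M`. [folklore] -/
theorem norm_mul_unitary_conjTranspose_apply_le {k κ : Matrix (Fin 2 ⊕ Fin 2) (Fin 2 ⊕ Fin 2) ℂ} (hk : k ∈ Matrix.unitaryGroup (Fin 2 ⊕ Fin 2) ℂ) {M : ℝ}
    (hM : 0 ≤ M) (hκe : ∀ i j, ‖κ i j‖ ≤ M) (i j : Fin 2 ⊕ Fin 2) : ‖(κ * kᴴ) i j‖ ≤ 4 * M := by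
  have hk' : kᴴ ∈ Matrix.unitaryGroup (Fin 2 ⊕ Fin 2) ℂ := by rw [← star_eq_conjTranspose]; exact Unitary.star_mem hk
  have h := K2LiuArchBlockHeightBound.norm_mul_apply_le hM hκe (fun i j => entry_norm_bound_of_unitary hk' i j) i j
  have h4 : (Fintype.card (Fin 2 ⊕ Fin 2) : ℝ) * (M * 1) = 4 * M := by simp [Fintype.card_sum, Fintype.card_fin]
  linarith

/-- **ROW COMPARISON**: entries of `V` below `K` ⇒ `Σ_j ‖(y V) i j‖² ≤ 4K² · Σ_j ‖y i j‖²` (2×2; Cauchy–Schwarz). [folklore] -/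
theorem rowSq_mul_le (y V : Matrix (Fin 2) (Fin 2) ℂ) {K : ℝ} (hV : ∀ i j, ‖V i j‖ ≤ K) (i : Fin 2) :
    ∑ j, ‖(y * V) i j‖ ^ 2 ≤ 4 * K ^ 2 * ∑ j, ‖y i j‖ ^ 2 := by
  have hentry : ∀ j, ‖(y * V) i j‖ ≤ K * ∑ l, ‖y i l‖ := fun j => by
    rw [Matrix.mul_apply]
    calc ‖∑ l, y i l * V l j‖ ≤ ∑ l, ‖y i l * V l j‖ := norm_sum_le _ _
      _ ≤ ∑ l, ‖y i l‖ * K := Finset.sum_le_sum fun l _ => by rw [norm_mul]; exact mul_le_mul_of_nonneg_left (hV l j) (norm_nonneg _)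
      _ = K * ∑ l, ‖y i l‖ := by rw [← Finset.sum_mul, mul_comm]
  have hS0 : 0 ≤ ∑ l, ‖y i l‖ := Finset.sum_nonneg fun l _ => norm_nonneg _
  have hcs : (∑ l, ‖y i l‖) ^ 2 ≤ 2 * ∑ l, ‖y i l‖ ^ 2 := by
    have h := sq_sum_le_card_mul_sum_sq fun l => ‖y i l‖
    simpa [Fintype.card_fin] using h
  calc ∑ j, ‖(y * V) i j‖ ^ 2 ≤ ∑ _j : Fin 2, (K * ∑ l, ‖y i l‖) ^ 2 :=
        Finset.sum_le_sum fun j _ => pow_le_pow_left₀ (norm_nonneg _) (hentry j) 2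
    _ = 2 * (K ^ 2 * (∑ l, ‖y i l‖) ^ 2) := by rw [Finset.sum_const, Finset.card_univ, Fintype.card_fin, nsmul_eq_mul, mul_pow]; push_cast; ring
    _ ≤ 2 * (K ^ 2 * (2 * ∑ l, ‖y i l‖ ^ 2)) := by gcongr
    _ = 4 * K ^ 2 * ∑ j, ‖y i j‖ ^ 2 := by ring

/-- a power of either sign of a two-sided comparable quantity: `0 < z`, `z ≤ K w`, `w ≤ K z` (`w > 0`) ⇒ `z^t ≤ K^{|t|} · w^t`. [folklore] -/
theorem rpow_le_mul_rpow_of_two_sided {z w K : ℝ} (hz : 0 < z) (hw : 0 < w) (h₁ : z ≤ K * w) (h₂ : w ≤ K * z) (t : ℝ) :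
    z ^ t ≤ K ^ |t| * w ^ t := by
  have hq : 0 < z / w := div_pos hz hw
  have hq₁ : z / w ≤ K := by rwa [div_le_iff₀ hw]
  have hq₂ : (z / w)⁻¹ ≤ K := by rw [inv_div, div_le_iff₀ hz]; exact h₂
  have h := rpow_le_rpow_abs hq hq₁ hq₂ t
  rw [Real.div_rpow hz.le hw.le, div_le_iff₀ (Real.rpow_pos_of_pos hw t)] at h
  exact h

include hι in
/-- **THE HEAD FOR `M`-BOUNDED MOVERS (payer-chosen rate).**  Same letters as §1 (with `C_L ≥ 0`); the block decomposition `g = [Y, B; 0, D]·κ ∈ U(J)` now only has a mover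
with `κ κ′ = 1` and entries of `κ, κ′` bounded by `M ≥ 1` (the class `hBL₁` quantifies over).  Comparing with a unitary-mover decomposition `g = [Y₀, B₀; 0, D₀]·k₀`
(★ p862843 `exists_blockUpper_mul_unitary`): `Y = Y₀ V₁₁`, `Y₀ = Y W₁₁` with `V = k₀κ′`, `W = κ k₀ᴴ` block-upper of entries `≤ 4M`, so `ρ, ρ₀` and `‖det Y‖, ‖det Y₀‖` are
comparable within `64M²`, `32M²`, and §1 at `(Y₀, k₀)` gives
`‖∫ f(ι(J₁ n₁(t)) · g) e^{−2πiμt} dt‖ ≤ C_L (64M²)^{|2re s+1|+1} (32M²)^{|2re s+2|} · ρ^{−(2re s+1)} ‖det Y‖^{2re s+2} ((1 + |μ|ρ) e^{−(π∕64M²)|μ|ρ})`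
— the Gaussian at the PAYER-CHOSEN rate `π∕(64M²)`; at the frozen rate `π` the `M`-bounded class cannot be served (the left side is mover-free, `ρ` is not).
[cite: BorelJacquet1979, §1.2, §4.1] [cite: MoeglinWaldspurger1995, I.2.2, II.1.7] [cite: Shimura1997, §16, §18.4] -/
theorem norm_corner_lineWhittaker_le_of_boundedMovers
    {χ : ℂ → ℂ} {s : ℂ} {f : Matrix (Fin 2 ⊕ Fin 2) (Fin 2 ⊕ Fin 2) ℂ → ℂ} (hf : IsArchSiegelSection χ s f) (hχ1 : χ 1 = 1)
    (hχ : ∀ z : ℂ, z ≠ 0 → ‖χ z‖ ≤ 1)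
    (hK : ∀ k : Matrix (Fin 2 ⊕ Fin 2) (Fin 2 ⊕ Fin 2) ℂ, kᴴ * Matrix.J (Fin 2) ℂ * k = Matrix.J (Fin 2) ℂ →
      moeb k (I • (1 : Matrix (Fin 2) (Fin 2) ℂ)) = I • 1 → ∃ ρ : ℂ, ‖ρ‖ ≤ 1 ∧ ∀ g, f (g * k) = ρ * f g)
    {CL : ℝ} (hCL : 0 ≤ CL)
    (hline : ∀ h : ℝ, ‖∫ t : ℝ, f (ι (Matrix.J (Fin 1) ℂ * fromBlocks 1 ((t : ℂ) • (1 : Matrix (Fin 1) (Fin 1) ℂ)) 0 1)) *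
        Complex.exp (-(2 * Real.pi * I * h * t))‖ ≤ CL * (1 + |h|) * Real.exp (-(Real.pi * |h|)))
    {M : ℝ} (hM : 1 ≤ M)
    {Y B D : Matrix (Fin 2) (Fin 2) ℂ} {κ κ' : Matrix (Fin 2 ⊕ Fin 2) (Fin 2 ⊕ Fin 2) ℂ}
    (hg : (fromBlocks Y B 0 D * κ)ᴴ * Matrix.J (Fin 2) ℂ * (fromBlocks Y B 0 D * κ) = Matrix.J (Fin 2) ℂ) (hκκ' : κ * κ' = 1)
    (hκe : ∀ i j, ‖κ i j‖ ≤ M) (hκe' : ∀ i j, ‖κ' i j‖ ≤ M) (μ : ℝ) :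
    ‖∫ t : ℝ, f (ι (Matrix.J (Fin 1) ℂ * fromBlocks 1 ((t : ℂ) • (1 : Matrix (Fin 1) (Fin 1) ℂ)) 0 1) * (fromBlocks Y B 0 D * κ)) *
        Complex.exp (-(2 * Real.pi * I * μ * t))‖ ≤
      CL * (64 * M ^ 2) ^ (|2 * s.re + 1| + 1) * (32 * M ^ 2) ^ |2 * s.re + 2| *
        ((∑ j, ‖Y 1 j‖ ^ 2) ^ (-(2 * s.re + 1)) * ‖Y.det‖ ^ (2 * s.re + 2) *
          ((1 + |μ| * ∑ j, ‖Y 1 j‖ ^ 2) * Real.exp (-(Real.pi / (64 * M ^ 2) * (|μ| * ∑ j, ‖Y 1 j‖ ^ 2))))) := by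
  have hM0 : 0 ≤ M := zero_le_one.trans hM
  have hκ'κ : κ' * κ = 1 := mul_eq_one_comm.1 hκκ'
  -- `g` is invertible (`(−J gᴴ J) g = 1`)
  have hJJ : Matrix.J (Fin 2) ℂ * Matrix.J (Fin 2) ℂ = -1 := Matrix.J_squared _ _
  have hginv : (-(Matrix.J (Fin 2) ℂ * (fromBlocks Y B 0 D * κ)ᴴ * Matrix.J (Fin 2) ℂ)) * (fromBlocks Y B 0 D * κ) = 1 := by
    rw [Matrix.neg_mul, Matrix.mul_assoc, Matrix.mul_assoc, ← Matrix.mul_assoc ((fromBlocks Y B 0 D * κ)ᴴ), hg, hJJ, neg_neg]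
  have hdetg : (fromBlocks Y B 0 D * κ).det ≠ 0 := by
    have h := congrArg Matrix.det hginv
    rw [det_mul, det_one] at h
    exact right_ne_zero_of_mul_eq_one h
  have hunit : IsUnit (fromBlocks Y B 0 D * κ) := (Matrix.isUnit_iff_isUnit_det _).2 (isUnit_iff_ne_zero.2 hdetg)
  -- the unitary-mover (QR) decomposition and §1 there
  obtain ⟨P, k₀, hk₀, hP21, hgP⟩ := exists_blockUpper_mul_unitary _ hunit
  have hk₀' : k₀ * k₀ᴴ = 1 := by simpa [Matrix.star_eq_conjTranspose] using Matrix.mem_unitaryGroup_iff.1 hk₀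
  have hk₀'' : k₀ᴴ * k₀ = 1 := by simpa [Matrix.star_eq_conjTranspose] using Matrix.mem_unitaryGroup_iff'.1 hk₀
  have hP : P = fromBlocks P.toBlocks₁₁ P.toBlocks₁₂ 0 P.toBlocks₂₂ := by
    conv_lhs => rw [← fromBlocks_toBlocks P, hP21]
  set Y₀ := P.toBlocks₁₁ with hY₀
  set B₀ := P.toBlocks₁₂ with hB₀
  set D₀ := P.toBlocks₂₂ with hD₀
  have hg₀ : fromBlocks Y B 0 D * κ = fromBlocks Y₀ B₀ 0 D₀ * k₀ := by rw [← hP]; exact hgP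
  have hg₀J : (fromBlocks Y₀ B₀ 0 D₀ * k₀)ᴴ * Matrix.J (Fin 2) ℂ * (fromBlocks Y₀ B₀ 0 D₀ * k₀) = Matrix.J (Fin 2) ℂ := by rw [← hg₀]; exact hg
  have hB := norm_corner_lineWhittaker_le_of_blockDecomp ι hι hf hχ1 hχ hK hline hg₀J hk₀' hk₀'' μ
  rw [← hg₀] at hB
  -- the comparison matrices `V = k₀ κ′`, `W = κ k₀ᴴ`
  have hPV : fromBlocks Y B 0 D = fromBlocks Y₀ B₀ 0 D₀ * (k₀ * κ') := by
    calc fromBlocks Y B 0 D = fromBlocks Y B 0 D * (κ * κ') := by rw [hκκ', Matrix.mul_one]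
      _ = (fromBlocks Y B 0 D * κ) * κ' := by rw [Matrix.mul_assoc]
      _ = fromBlocks Y₀ B₀ 0 D₀ * (k₀ * κ') := by rw [hg₀, Matrix.mul_assoc]
  have hPW : fromBlocks Y₀ B₀ 0 D₀ = fromBlocks Y B 0 D * (κ * k₀ᴴ) := by
    calc fromBlocks Y₀ B₀ 0 D₀ = fromBlocks Y₀ B₀ 0 D₀ * (k₀ * k₀ᴴ) := by rw [hk₀', Matrix.mul_one]
      _ = (fromBlocks Y₀ B₀ 0 D₀ * k₀) * k₀ᴴ := by rw [Matrix.mul_assoc]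
      _ = fromBlocks Y B 0 D * (κ * k₀ᴴ) := by rw [← hg₀, Matrix.mul_assoc]
  -- invertibility of `D₀` and `D`
  have hdetk₀ : k₀.det ≠ 0 := by
    intro h0
    have h := congrArg Matrix.det hk₀'
    rw [det_mul, h0, zero_mul, det_one] at h
    exact zero_ne_one h
  have hdetD₀ : D₀.det ≠ 0 := by
    intro h0
    apply hdetg
    rw [hg₀, det_mul, Matrix.det_fromBlocks_zero₂₁, h0, mul_zero, zero_mul]
  have hdetκ : κ.det ≠ 0 := by
    intro h0
    have h := congrArg Matrix.det hκκ'
    rw [det_mul, h0, zero_mul, det_one] at h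
    exact zero_ne_one h
  have hdetD : D.det ≠ 0 := by
    intro h0
    apply hdetg
    rw [det_mul, Matrix.det_fromBlocks_zero₂₁, h0, mul_zero, zero_mul]
  -- `Y = Y₀ V₁₁`, `Y₀ = Y W₁₁`
  have hVblocks := hPV
  rw [← fromBlocks_toBlocks (k₀ * κ'), fromBlocks_multiply] at hVblocks
  simp only [Matrix.zero_mul, zero_add, fromBlocks_inj] at hVblocks
  obtain ⟨hY, -, hV21, -⟩ := hVblocks
  have hV21' : (k₀ * κ').toBlocks₂₁ = 0 := by
    have h := congrArg (fun X => D₀⁻¹ * X) hV21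
    simpa only [← Matrix.mul_assoc, Matrix.nonsing_inv_mul _ (isUnit_iff_ne_zero.2 hdetD₀), Matrix.one_mul, Matrix.mul_zero] using h.symm
  rw [hV21', Matrix.mul_zero, add_zero] at hY
  have hWblocks := hPW
  rw [← fromBlocks_toBlocks (κ * k₀ᴴ), fromBlocks_multiply] at hWblocks
  simp only [Matrix.zero_mul, zero_add, fromBlocks_inj] at hWblocks
  obtain ⟨hY₀, -, hW21, -⟩ := hWblocks
  have hW21' : (κ * k₀ᴴ).toBlocks₂₁ = 0 := by
    have h := congrArg (fun X => D⁻¹ * X) hW21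
    simpa only [← Matrix.mul_assoc, Matrix.nonsing_inv_mul _ (isUnit_iff_ne_zero.2 hdetD), Matrix.one_mul, Matrix.mul_zero] using h.symm
  rw [hW21', Matrix.mul_zero, add_zero] at hY₀
  -- entry bounds `≤ 4M` for `V₁₁`, `W₁₁`
  have hVe : ∀ i j, ‖(k₀ * κ').toBlocks₁₁ i j‖ ≤ 4 * M := fun i j => norm_unitary_mul_apply_le hk₀ hκe' _ _
  have hWe : ∀ i j, ‖(κ * k₀ᴴ).toBlocks₁₁ i j‖ ≤ 4 * M := fun i j => norm_mul_unitary_conjTranspose_apply_le hk₀ hM0 hκe _ _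
  -- the two corner rows and the two determinants, two-sided within `64M²`, `32M²`
  have hρle : ∑ j, ‖Y 1 j‖ ^ 2 ≤ 64 * M ^ 2 * ∑ j, ‖Y₀ 1 j‖ ^ 2 := by
    have h := rowSq_mul_le Y₀ _ hVe 1
    rw [← hY] at h
    linarith
  have hρ₀le : ∑ j, ‖Y₀ 1 j‖ ^ 2 ≤ 64 * M ^ 2 * ∑ j, ‖Y 1 j‖ ^ 2 := by
    have h := rowSq_mul_le Y _ hWe 1
    rw [← hY₀] at h
    linarith
  have hdetVle : ‖((k₀ * κ').toBlocks₁₁).det‖ ≤ 32 * M ^ 2 := by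
    have h := norm_det_le_of_entry_le hVe
    simp only [Fintype.card_fin, Nat.factorial_two, Nat.cast_ofNat] at h
    linarith
  have hdetWle : ‖((κ * k₀ᴴ).toBlocks₁₁).det‖ ≤ 32 * M ^ 2 := by
    have h := norm_det_le_of_entry_le hWe
    simp only [Fintype.card_fin, Nat.factorial_two, Nat.cast_ofNat] at h
    linarith
  have hδle : ‖Y.det‖ ≤ 32 * M ^ 2 * ‖Y₀.det‖ := by
    rw [hY, det_mul, norm_mul, mul_comm]
    exact mul_le_mul_of_nonneg_right hdetVle (norm_nonneg _)
  have hδ₀le : ‖Y₀.det‖ ≤ 32 * M ^ 2 * ‖Y.det‖ := by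
    rw [hY₀, det_mul, norm_mul, mul_comm ‖Y.det‖]
    exact mul_le_mul_of_nonneg_right hdetWle (norm_nonneg _)
  -- positivity of the four sizes
  have hdetY : Y.det ≠ 0 := by
    intro h0; apply hdetg; rw [det_mul, Matrix.det_fromBlocks_zero₂₁, h0, zero_mul, zero_mul]
  have hdetY₀ : Y₀.det ≠ 0 := by
    intro h0; apply hdetg; rw [hg₀, det_mul, Matrix.det_fromBlocks_zero₂₁, h0, zero_mul, zero_mul]
  have hδ : 0 < ‖Y.det‖ := norm_pos_iff.2 hdetY
  have hδ₀ : 0 < ‖Y₀.det‖ := norm_pos_iff.2 hdetY₀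
  have hrow_pos : ∀ {Z : Matrix (Fin 2) (Fin 2) ℂ}, Z.det ≠ 0 → 0 < ∑ j, ‖Z 1 j‖ ^ 2 := fun {Z} hZ => by
    by_contra hle
    have h0 : ∑ j, ‖Z 1 j‖ ^ 2 = 0 := le_antisymm (not_lt.1 hle) (Finset.sum_nonneg fun j _ => sq_nonneg _)
    rw [Finset.sum_eq_zero_iff_of_nonneg fun j _ => sq_nonneg _] at h0
    have hz : ∀ j, Z 1 j = 0 := fun j => norm_eq_zero.1 (pow_eq_zero_iff two_ne_zero |>.1 (h0 j (Finset.mem_univ j)))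
    apply hZ
    rw [Matrix.det_fin_two, hz 0, hz 1, mul_zero, mul_zero, sub_zero]
  have hρ : 0 < ∑ j, ‖Y 1 j‖ ^ 2 := hrow_pos hdetY
  have hρ₀ : 0 < ∑ j, ‖Y₀ 1 j‖ ^ 2 := hrow_pos hdetY₀
  -- conversion of the four factors
  have h64 : (1 : ℝ) ≤ 64 * M ^ 2 := by nlinarith
  have hf1 : (∑ j, ‖Y₀ 1 j‖ ^ 2) ^ (-(2 * s.re + 1)) ≤ (64 * M ^ 2) ^ |2 * s.re + 1| * (∑ j, ‖Y 1 j‖ ^ 2) ^ (-(2 * s.re + 1)) := by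
    have h := rpow_le_mul_rpow_of_two_sided hρ₀ hρ hρ₀le hρle (-(2 * s.re + 1))
    rwa [abs_neg] at h
  have hf2 : ‖Y₀.det‖ ^ (2 * s.re + 2) ≤ (32 * M ^ 2) ^ |2 * s.re + 2| * ‖Y.det‖ ^ (2 * s.re + 2) :=
    rpow_le_mul_rpow_of_two_sided hδ₀ hδ hδ₀le hδle _
  have hf3 : 1 + |μ| * ∑ j, ‖Y₀ 1 j‖ ^ 2 ≤ 64 * M ^ 2 * (1 + |μ| * ∑ j, ‖Y 1 j‖ ^ 2) := by
    have hμ : 0 ≤ |μ| := abs_nonneg μ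
    nlinarith [mul_le_mul_of_nonneg_left hρ₀le hμ, hρ.le]
  have hf4 : Real.exp (-(Real.pi * (|μ| * ∑ j, ‖Y₀ 1 j‖ ^ 2))) ≤ Real.exp (-(Real.pi / (64 * M ^ 2) * (|μ| * ∑ j, ‖Y 1 j‖ ^ 2))) := by
    rw [Real.exp_le_exp, neg_le_neg_iff]
    have hμ : 0 ≤ |μ| := abs_nonneg μ
    have h1 : Real.pi / (64 * M ^ 2) * (|μ| * ∑ j, ‖Y 1 j‖ ^ 2) ≤ Real.pi / (64 * M ^ 2) * (|μ| * (64 * M ^ 2 * ∑ j, ‖Y₀ 1 j‖ ^ 2)) :=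
      mul_le_mul_of_nonneg_left (mul_le_mul_of_nonneg_left hρle hμ) (by positivity)
    have h2 : Real.pi / (64 * M ^ 2) * (|μ| * (64 * M ^ 2 * ∑ j, ‖Y₀ 1 j‖ ^ 2)) = Real.pi * (|μ| * ∑ j, ‖Y₀ 1 j‖ ^ 2) := by
      field_simp
    linarith
  -- assemble
  have hA0 : 0 ≤ (64 * M ^ 2) ^ |2 * s.re + 1| * (∑ j, ‖Y 1 j‖ ^ 2) ^ (-(2 * s.re + 1)) := by positivity
  have hB0 : 0 ≤ (32 * M ^ 2) ^ |2 * s.re + 2| * ‖Y.det‖ ^ (2 * s.re + 2) := by positivity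
  have hE0 : 0 ≤ Real.exp (-(Real.pi * (|μ| * ∑ j, ‖Y₀ 1 j‖ ^ 2))) := (Real.exp_pos _).le
  have hC0 : 0 ≤ 1 + |μ| * ∑ j, ‖Y₀ 1 j‖ ^ 2 := by positivity
  calc _ ≤ CL * (∑ j, ‖Y₀ 1 j‖ ^ 2) ^ (-(2 * s.re + 1)) * ‖Y₀.det‖ ^ (2 * s.re + 2) *
        ((1 + |μ| * ∑ j, ‖Y₀ 1 j‖ ^ 2) * Real.exp (-(Real.pi * (|μ| * ∑ j, ‖Y₀ 1 j‖ ^ 2)))) := hB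
    _ ≤ CL * ((64 * M ^ 2) ^ |2 * s.re + 1| * (∑ j, ‖Y 1 j‖ ^ 2) ^ (-(2 * s.re + 1))) * ((32 * M ^ 2) ^ |2 * s.re + 2| * ‖Y.det‖ ^ (2 * s.re + 2)) *
        ((64 * M ^ 2 * (1 + |μ| * ∑ j, ‖Y 1 j‖ ^ 2)) * Real.exp (-(Real.pi / (64 * M ^ 2) * (|μ| * ∑ j, ‖Y 1 j‖ ^ 2)))) := by
        gcongr
    _ = CL * ((64 * M ^ 2) ^ |2 * s.re + 1| * (64 * M ^ 2)) * (32 * M ^ 2) ^ |2 * s.re + 2| *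
        ((∑ j, ‖Y 1 j‖ ^ 2) ^ (-(2 * s.re + 1)) * ‖Y.det‖ ^ (2 * s.re + 2) *
          ((1 + |μ| * ∑ j, ‖Y 1 j‖ ^ 2) * Real.exp (-(Real.pi / (64 * M ^ 2) * (|μ| * ∑ j, ‖Y 1 j‖ ^ 2))))) := by ring
    _ = _ := by rw [Real.rpow_add_one (by positivity : (64 * M ^ 2 : ℝ) ≠ 0)]

end BoundedMovers


end Summit.HodgeConjecture.HodgeConjecture.Cruxes.HLiu418.K2LiuKindOneLineCornerArchFactorBounded

end
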